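import Mathlib.Combinatorics.SetFamily.FourFunctions
import Literature.Combinatorics.Sahi2008.FKG
import Mathlib.Tactic.Linarith
import Mathlib.Tactic.Ring
import HarnessLib

/-!
# `NoHeavyLowerTail` (crux stmt-CriticalPhenomena-4575), master-family line P1 (gen 22):
# second-order Harris for sunflowers, VI — ITERATED FOUR-FUNCTIONS CERTIFICATES: a bias-free stratum of the kernel branch (and, dually,
# of the outside branch) of SOH_k, for every log-supermodular weight on every finite distributive lattice

Support file (seat `prim-masterthm-p1`, gen 22; `--supports stmt-CriticalPhenomena-4575`).  Standard axioms, no `sorry`; one small definition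
(the certificate format `ADChain`).  Memo `run/shared/lean/prim/prim-masterthm/FROM-prim-masterthm-p1-g22-SUNFLOWER-ONE-PAYER.md` §10.

THE MECHANISM.  For a log-supermodular weight `μ ≥ 0` on a finite distributive lattice (`μ(a)μ(b) ≤ μ(a ⊓ b)μ(a ⊔ b)`), the Ahlswede–Daykin
four functions theorem (Mathlib's `four_functions_theorem`, all four functions `= μ`) gives for any two finite sets `S, T`:
`w(S)·w(T) ≤ w(S ⊼ T)·w(S ⊻ T)` (`w` = `μ`-mass, `⊼/⊻` = pointwise infs/sups).  ITERATING along an ordering `U_1, U_2, …, U_m` of the members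
of a sunflower with kernel `K` (all pairwise `U_i ⊻ U_j ⊆ K` since the members are up-sets meeting in `K`): with `P_1 = U_1`, `P_{a+1} = P_a ⊼ U_{a+1}`,
**if `P_a ⊻ U_{a+1} ⊆ K` for every `a` (`ADChain K U_1 [U_2, …, U_m]`) then `Π_i w(U_i) ≤ w(K)^{m−1}`** for EVERY such `μ` of total mass `≤ 1`
(`prod_mass_le_kernel_pow_of_adChain`) — the kernel branch of SOH_m (`SahiDeepCore.SunflowerOnePayer`, `SahiSunflowerFKG.OnePayerFKG`) on this
stratum, at every bias / for every FKG weight, with no hypothesis on `μ(O)`.  The condition holds for any order when `K` is closed under `⊓`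
(e.g. a principal up-set: then `⊓_i (x_i ⊔ z) ∈ K`), so this contains `…SahiSunflowerPrincipalKernel` and extends it from product to FKG weights;
on `2^4` it certifies 355 of the 1 014 kernel/outside systems with `3 ≤ m ≤ 5` components, and on the planar lattices `[4]²`, `[5]×[4]` all but
`1/60`, `10/288` systems (census `code-g22/adchain.py`).  Dual format `ADChainDual O D_1 [D_2, …]` (`P_a ⊼ D_{a+1} ⊆ O`, accumulate sups) gives
`Π_i w(D_i) ≤ w(O)^{m−1}` (`prod_mass_le_outside_pow_of_adChainDual`).
HONEST FRAMING: a certificate format and its soundness; SOH_k itself remains OPEN. [this work]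
-/

namespace Summit.CriticalPhenomena.PercolationContinuityZ3.Theorems

namespace SahiSunflowerAD

open Finset
open scoped FinsetFamily

variable {α : Type} [DistribLattice α] [DecidableEq α]

/-- **Iterated four-functions certificate (kernel side).**  `ADChain K P [U_1, …, U_r]`: `P ⊻ U_1 ⊆ K`, and recursively
`ADChain K (P ⊼ U_1) [U_2, …, U_r]`. [this work] -/
def ADChain (K : Finset α) : Finset α → List (Finset α) → Prop
  | _, [] => True
  | P, U :: l => P ⊻ U ⊆ K ∧ ADChain K (P ⊼ U) l

/-- **Dual certificate (outside side).**  `ADChainDual O P [D_1, …, D_r]`: `P ⊼ D_1 ⊆ O`, and recursively on `P ⊻ D_1`. [this work] -/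
def ADChainDual (O : Finset α) : Finset α → List (Finset α) → Prop
  | _, [] => True
  | P, D :: l => P ⊼ D ⊆ O ∧ ADChainDual O (P ⊻ D) l

/-- The empty certificate. [this work] -/
@[simp] theorem adChain_nil (K P : Finset α) : ADChain K P [] := trivial

/-- Unfolding one step of the certificate. [this work] -/
theorem adChain_cons {K P U : Finset α} {l : List (Finset α)} :
    ADChain K P (U :: l) ↔ P ⊻ U ⊆ K ∧ ADChain K (P ⊼ U) l := Iff.rfl

/-- The empty dual certificate. [this work] -/
@[simp] theorem adChainDual_nil (O P : Finset α) : ADChainDual O P [] := trivial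

/-- Unfolding one step of the dual certificate. [this work] -/
theorem adChainDual_cons {O P D : Finset α} {l : List (Finset α)} :
    ADChainDual O P (D :: l) ↔ P ⊼ D ⊆ O ∧ ADChainDual O (P ⊻ D) l := Iff.rfl

variable (μ : α → ℝ)

/-- The one-step inequality `w(S)·w(T) ≤ w(S ⊼ T)·w(S ⊻ T)` for a nonnegative log-supermodular weight (the four functions theorem with all
four functions equal to `μ`). [cite: AhlswedeDaykin1978, Thm. 1] -/
theorem mass_mul_le_infs_mul_sups (hμ0 : ∀ a, 0 ≤ μ a) (hμ : ∀ a b, μ a * μ b ≤ μ (a ⊓ b) * μ (a ⊔ b))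
    (S T : Finset α) :
    (∑ a ∈ S, μ a) * (∑ a ∈ T, μ a) ≤ (∑ a ∈ S ⊼ T, μ a) * (∑ a ∈ S ⊻ T, μ a) :=
  four_functions_theorem μ μ μ μ (fun a => hμ0 a) (fun a => hμ0 a) (fun a => hμ0 a) (fun a => hμ0 a) hμ S T

variable [Fintype α]

omit [DistribLattice α] [DecidableEq α] in
/-- Masses of subsets are at most the total mass. [folklore] -/
theorem mass_le_total (hμ0 : ∀ a, 0 ≤ μ a) (S : Finset α) : ∑ a ∈ S, μ a ≤ ∑ a, μ a :=
  Finset.sum_le_sum_of_subset_of_nonneg (Finset.subset_univ S) fun a _ _ => hμ0 a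

/-- **SOUNDNESS of the kernel certificate (every log-supermodular weight of total mass ≤ 1).**
If `ADChain K P l` then `w(P) · Π_{U ∈ l} w(U) ≤ w(K)^{|l|}`. [this work] -/
theorem mass_mul_prod_le_pow_of_adChain (hμ0 : ∀ a, 0 ≤ μ a) (hμ : ∀ a b, μ a * μ b ≤ μ (a ⊓ b) * μ (a ⊔ b))
    (hμ1 : ∑ a, μ a ≤ 1) (K : Finset α) :
    ∀ (l : List (Finset α)) (P : Finset α), ADChain K P l →
      (∑ a ∈ P, μ a) * (l.map fun U => ∑ a ∈ U, μ a).prod ≤ (∑ a ∈ K, μ a) ^ l.length := by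
  intro l
  induction l with
  | nil =>
    intro P _
    simp only [List.map_nil, List.prod_nil, mul_one, List.length_nil, pow_zero]
    exact le_trans (mass_le_total μ hμ0 P) hμ1
  | cons U l ih =>
    intro P h
    rw [adChain_cons] at h
    obtain ⟨hsup, hrest⟩ := h
    have hK0 : 0 ≤ ∑ a ∈ K, μ a := Finset.sum_nonneg fun a _ => hμ0 a
    have hprod0 : 0 ≤ (l.map fun U => ∑ a ∈ U, μ a).prod :=
      List.prod_nonneg fun x hx => by
        obtain ⟨V, -, rfl⟩ := List.mem_map.1 hx
        exact Finset.sum_nonneg fun a _ => hμ0 a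
    have hsupK : ∑ a ∈ P ⊻ U, μ a ≤ ∑ a ∈ K, μ a := Finset.sum_le_sum_of_subset_of_nonneg hsup fun a _ _ => hμ0 a
    have hinf0 : 0 ≤ ∑ a ∈ P ⊼ U, μ a := Finset.sum_nonneg fun a _ => hμ0 a
    simp only [List.map_cons, List.prod_cons, List.length_cons, pow_succ]
    calc (∑ a ∈ P, μ a) * ((∑ a ∈ U, μ a) * (l.map fun U => ∑ a ∈ U, μ a).prod)
        = ((∑ a ∈ P, μ a) * (∑ a ∈ U, μ a)) * (l.map fun U => ∑ a ∈ U, μ a).prod := by ring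
      _ ≤ ((∑ a ∈ P ⊼ U, μ a) * (∑ a ∈ P ⊻ U, μ a)) * (l.map fun U => ∑ a ∈ U, μ a).prod :=
          mul_le_mul_of_nonneg_right (mass_mul_le_infs_mul_sups μ hμ0 hμ P U) hprod0
      _ ≤ ((∑ a ∈ P ⊼ U, μ a) * (∑ a ∈ K, μ a)) * (l.map fun U => ∑ a ∈ U, μ a).prod :=
          mul_le_mul_of_nonneg_right (mul_le_mul_of_nonneg_left hsupK hinf0) hprod0
      _ = (∑ a ∈ K, μ a) * ((∑ a ∈ P ⊼ U, μ a) * (l.map fun U => ∑ a ∈ U, μ a).prod) := by ring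
      _ ≤ (∑ a ∈ K, μ a) * (∑ a ∈ K, μ a) ^ l.length :=
          mul_le_mul_of_nonneg_left (ih (P ⊼ U) hrest) hK0
      _ = (∑ a ∈ K, μ a) ^ l.length * ∑ a ∈ K, μ a := by ring

/-- **KERNEL BRANCH of SOH_m from a certificate.**  For members `U_1, …, U_m` (any finite sets) and a set `K` with `ADChain K U_1 [U_2, …, U_m]`:
`Π_i w(U_i) ≤ w(K)^{m−1}` for every nonnegative log-supermodular weight of total mass `≤ 1` — in particular for every FKG probability weight,
every sunflower of up-sets with kernel `K` admitting such an order, WITHOUT any hypothesis on the outside mass. [this work] -/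
theorem prod_mass_le_kernel_pow_of_adChain (hμ0 : ∀ a, 0 ≤ μ a) (hμ : ∀ a b, μ a * μ b ≤ μ (a ⊓ b) * μ (a ⊔ b))
    (hμ1 : ∑ a, μ a ≤ 1) (K U : Finset α) (l : List (Finset α)) (h : ADChain K U l) :
    ((U :: l).map fun V => ∑ a ∈ V, μ a).prod ≤ (∑ a ∈ K, μ a) ^ ((U :: l).length - 1) := by
  simp only [List.map_cons, List.prod_cons, List.length_cons, Nat.add_sub_cancel]
  exact mass_mul_prod_le_pow_of_adChain μ hμ0 hμ hμ1 K l U h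

/-- **SOUNDNESS of the dual certificate**: if `ADChainDual O P l` then `w(P) · Π_{D ∈ l} w(D) ≤ w(O)^{|l|}`. [this work] -/
theorem mass_mul_prod_le_pow_of_adChainDual (hμ0 : ∀ a, 0 ≤ μ a) (hμ : ∀ a b, μ a * μ b ≤ μ (a ⊓ b) * μ (a ⊔ b))
    (hμ1 : ∑ a, μ a ≤ 1) (O : Finset α) :
    ∀ (l : List (Finset α)) (P : Finset α), ADChainDual O P l →
      (∑ a ∈ P, μ a) * (l.map fun D => ∑ a ∈ D, μ a).prod ≤ (∑ a ∈ O, μ a) ^ l.length := by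
  intro l
  induction l with
  | nil =>
    intro P _
    simp only [List.map_nil, List.prod_nil, mul_one, List.length_nil, pow_zero]
    exact le_trans (mass_le_total μ hμ0 P) hμ1
  | cons D l ih =>
    intro P h
    rw [adChainDual_cons] at h
    obtain ⟨hinf, hrest⟩ := h
    have hO0 : 0 ≤ ∑ a ∈ O, μ a := Finset.sum_nonneg fun a _ => hμ0 a
    have hprod0 : 0 ≤ (l.map fun D => ∑ a ∈ D, μ a).prod :=
      List.prod_nonneg fun x hx => by
        obtain ⟨V, -, rfl⟩ := List.mem_map.1 hx
        exact Finset.sum_nonneg fun a _ => hμ0 a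
    have hinfO : ∑ a ∈ P ⊼ D, μ a ≤ ∑ a ∈ O, μ a := Finset.sum_le_sum_of_subset_of_nonneg hinf fun a _ _ => hμ0 a
    have hsup0 : 0 ≤ ∑ a ∈ P ⊻ D, μ a := Finset.sum_nonneg fun a _ => hμ0 a
    simp only [List.map_cons, List.prod_cons, List.length_cons, pow_succ]
    calc (∑ a ∈ P, μ a) * ((∑ a ∈ D, μ a) * (l.map fun D => ∑ a ∈ D, μ a).prod)
        = ((∑ a ∈ P, μ a) * (∑ a ∈ D, μ a)) * (l.map fun D => ∑ a ∈ D, μ a).prod := by ring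
      _ ≤ ((∑ a ∈ P ⊼ D, μ a) * (∑ a ∈ P ⊻ D, μ a)) * (l.map fun D => ∑ a ∈ D, μ a).prod :=
          mul_le_mul_of_nonneg_right (mass_mul_le_infs_mul_sups μ hμ0 hμ P D) hprod0
      _ ≤ ((∑ a ∈ O, μ a) * (∑ a ∈ P ⊻ D, μ a)) * (l.map fun D => ∑ a ∈ D, μ a).prod :=
          mul_le_mul_of_nonneg_right (mul_le_mul_of_nonneg_right hinfO hsup0) hprod0
      _ = (∑ a ∈ O, μ a) * ((∑ a ∈ P ⊻ D, μ a) * (l.map fun D => ∑ a ∈ D, μ a).prod) := by ring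
      _ ≤ (∑ a ∈ O, μ a) * (∑ a ∈ O, μ a) ^ l.length :=
          mul_le_mul_of_nonneg_left (ih (P ⊻ D) hrest) hO0
      _ = (∑ a ∈ O, μ a) ^ l.length * ∑ a ∈ O, μ a := by ring

/-- **OUTSIDE BRANCH of SOH_m from a dual certificate.** [this work] -/
theorem prod_mass_le_outside_pow_of_adChainDual (hμ0 : ∀ a, 0 ≤ μ a) (hμ : ∀ a b, μ a * μ b ≤ μ (a ⊓ b) * μ (a ⊔ b))
    (hμ1 : ∑ a, μ a ≤ 1) (O D : Finset α) (l : List (Finset α)) (h : ADChainDual O D l) :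
    ((D :: l).map fun V => ∑ a ∈ V, μ a).prod ≤ (∑ a ∈ O, μ a) ^ ((D :: l).length - 1) := by
  simp only [List.map_cons, List.prod_cons, List.length_cons, Nat.add_sub_cancel]
  exact mass_mul_prod_le_pow_of_adChainDual μ hμ0 hμ hμ1 O l D h

/-- **FKG-weight form** (Sahi's `IsFKGMeasure`): a kernel certificate gives `Π_i w(U_i) ≤ w(K)^{m−1}` for every FKG probability weight on a
finite distributive lattice. [this work] -/
theorem prod_mass_le_kernel_pow_of_adChain_fkg {μ : α → ℝ} (hμ : Literature.Combinatorics.Sahi2008.IsFKGMeasure μ)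
    (K U : Finset α) (l : List (Finset α)) (h : ADChain K U l) :
    ((U :: l).map fun V => ∑ a ∈ V, μ a).prod ≤ (∑ a ∈ K, μ a) ^ ((U :: l).length - 1) :=
  prod_mass_le_kernel_pow_of_adChain μ hμ.nonneg hμ.mul_le_mul hμ.sum_eq_one.le K U l h

/-- **FKG-weight form of the dual certificate.** [this work] -/
theorem prod_mass_le_outside_pow_of_adChainDual_fkg {μ : α → ℝ} (hμ : Literature.Combinatorics.Sahi2008.IsFKGMeasure μ)
    (O D : Finset α) (l : List (Finset α)) (h : ADChainDual O D l) :
    ((D :: l).map fun V => ∑ a ∈ V, μ a).prod ≤ (∑ a ∈ O, μ a) ^ ((D :: l).length - 1) :=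
  prod_mass_le_outside_pow_of_adChainDual μ hμ.nonneg hμ.mul_le_mul hμ.sum_eq_one.le O D l h


/-! ### A sufficient condition: inf-closed kernels (any order works) -/

omit [Fintype α] in
/-- If `K` is closed under `⊓`, every `P` whose sups with all members of `l` lie in `K`, followed by members with pairwise sups in `K`,
carries a certificate: `((p ⊓ u) ⊔ v) = (p ⊔ v) ⊓ (u ⊔ v)` (distributivity). [this work] -/
theorem adChain_of_infClosed {K : Finset α} (hK : InfClosed (K : Set α)) :
    ∀ (l : List (Finset α)) (P : Finset α), (∀ V ∈ l, P ⊻ V ⊆ K) → l.Pairwise (fun U V => U ⊻ V ⊆ K) → ADChain K P l := by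
  intro l
  induction l with
  | nil => intro P _ _; trivial
  | cons U l ih =>
    intro P hP hl
    rw [List.pairwise_cons] at hl
    obtain ⟨hU, hl'⟩ := hl
    refine ⟨hP U (by simp), ih (P ⊼ U) (fun V hV => ?_) hl'⟩
    intro c hc
    rw [Finset.mem_sups] at hc
    obtain ⟨q, hq, v, hv, rfl⟩ := hc
    rw [Finset.mem_infs] at hq
    obtain ⟨p', hp', u, hu, rfl⟩ := hq
    rw [sup_inf_right]
    have h1 : p' ⊔ v ∈ K := hP V (by simp [hV]) (Finset.sup_mem_sups hp' hv)
    have h2 : u ⊔ v ∈ K := hU V hV (Finset.sup_mem_sups hu hv)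
    exact hK (Finset.mem_coe.2 h1) (Finset.mem_coe.2 h2)

/-- **Inf-closed kernels pay, for every FKG weight (all `m`).**  If the members `U_1, …, U_m` have pairwise sups inside an inf-closed `K`
(e.g. a sunflower of up-sets whose kernel `K` is closed under `⊓` — a principal up-set, an AND-event), then `Π_i w(U_i) ≤ w(K)^{m−1}` for every
nonnegative log-supermodular weight of total mass `≤ 1`.  (The Aharoni–Keich / `…SahiSunflowerPrincipalKernel` stratum, now for FKG weights.) [this work] -/
theorem prod_mass_le_kernel_pow_of_infClosed (hμ0 : ∀ a, 0 ≤ μ a) (hμ : ∀ a b, μ a * μ b ≤ μ (a ⊓ b) * μ (a ⊔ b))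
    (hμ1 : ∑ a, μ a ≤ 1) {K : Finset α} (hK : InfClosed (K : Set α)) (U : Finset α) (l : List (Finset α))
    (hpair : (U :: l).Pairwise (fun V W => V ⊻ W ⊆ K)) :
    ((U :: l).map fun V => ∑ a ∈ V, μ a).prod ≤ (∑ a ∈ K, μ a) ^ ((U :: l).length - 1) := by
  rw [List.pairwise_cons] at hpair
  exact prod_mass_le_kernel_pow_of_adChain μ hμ0 hμ hμ1 K U l (adChain_of_infClosed hK l U hpair.1 hpair.2)

end SahiSunflowerAD

end Summit.CriticalPhenomena.PercolationContinuityZ3.Theorems
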